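import Summits.QuantumFields.BalabanUV.T4Continuum.Spine.NE3.PairReg335B8
import Literature.MathematicalPhysics.QuantumFieldTheory.Balaban1983to89.B8Thm4TorusAt
import HarnessLib

/-!
# T⁴ programme, node NE3 (pub-ymgap DAG node N16) — [B8] THEOREM 4 IN THE ALL-TORUS GEOMETRY (`Ω_j = T_η`, p. 77) APPLIES AT THE
# MINIMISER PAIR, WITH (1.33)'s SECOND CLAUSE DISCHARGED: the torus interface `B8Thm4TorusAt.Thm4TorusAt L k (N·Lᵏ) (Lᵏ)⁻¹ c₁ unitaryUnits
# (Reg335Zd (Lᵏ)⁻¹ L 𝒬 C) Restr Concl` yields, for `(U₀, U) = (W, U_A)`, `W = rescale L (bavg L U_B)`, a UNIQUE PERIODIC unitary `u` with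
# `Restr W u` and `Concl α (11d²α) W U′ u` from row NE3's leaf data ALONE (`PairThm4TorusB8`)

Cell `pub-ymgap`, HUMAN RULING D-0062, seat `pub-ymgap-dag-n16-b` (FIRST-MISSING-ESTIMATE for N16 = NE3; writer prover-pub-ymgap-dag-n16-b-g2-0,
2026-08-26).  The torus twin of this seat's `Spine/NE3/PairThm4AtB8` (g0) ∕ `Spine/NE3/PairReg335B8` (g2), written after the census finding
[N16B-CENSUS + INTERFACE-GAP-1] (pub-ymgap INBOX 2026-08-26T03:39Z): THE END's `PairLandauGaugeB8Avg` is [B8] Theorem 2∕4 for the domain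
sequence `Ω_j = T_η` (reading (R-a)), which the cube-family interface `B8Eq119TwistedAxial.Thm4At` (family (1.131) of Prop. 6) does not
instantiate; `Literature/…/B8Thm4TorusAt` types the torus instance and this file applies it at the pair.

WHAT ([folklore]; 0 def, 0 sorry): **`concl_of_thm4TorusAt_minimisers_reg335`** — for `d ≥ 1`, `L ≥ 2`, `U_A` a run-`k` and `U_B` a
run-`(k+1)` minimiser over `sfClass d L N ε` with the same datum, (H3ˢᵘᵖ) letters `RegularSup d L N b c k U_A`, `RegularSup d L N b c (k+1) U_B`,
the regime lines and one letter `α` above the radii (as in `PairThm4AtB8`), a cube family `𝒬` of `ℓ¹`-radius parameter `Mc` (`j ≤ k`) with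
`(Mc+1)·α_W ≤ ½` and `C` above `PairReg335B8.reg335Zd_rescale_bavg`'s threshold: IF Theorem 4 holds in the torus form
`Thm4TorusAt L k (N·Lᵏ) (Lᵏ)⁻¹ c₁ unitaryUnits (Reg335Zd (Lᵏ)⁻¹ L 𝒬 C) Restr Concl` with `α + 11d²α ≤ c₁`, THEN there is exactly one
`(N·Lᵏ)`-PERIODIC unitary `u` with `Restr W u` and `Concl α (11d²α) W U′ u`, `U′ = U_A^{u₀}·W⁻¹`, `u₀ = ptw L W U_A k`.  No hypothesis on the
background or on the pair beyond the leaf letters: `𝔄_k({T_η}, α)` for `W, U_A` (`PairClassAkB8.inAk_pair` at `Ω_j = univ`), (1.34)'s axial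
clause for `torusLam` and (1.66) at all levels (`B8Thm4TorusAt.concl_of_thm4TorusAt_pair`), (3.35) (`PairReg335B8.reg335Zd_rescale_bavg`),
periodicity (class data).
HONEST FRAMING (page 1): `Thm4TorusAt` ([B8] Thm 4 at a curved background on the torus — N05's) is a HYPOTHESIS; the (H3ˢᵘᵖ) letters are [B11]
Thm 1 TYPE hypotheses; Thm 4 ∕ Thm 2 ∕ NE3 NOT proved; spine 0∕9; finite T⁴ rung (B)+1 at fixed ε — NOT infinite volume, NOT mass gap, NOT
`BetaPertH`, NOT Clay.  PLACEMENT: `Spine/NE3/`.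
-/

set_option autoImplicit false

open scoped BigOperators Matrix Matrix.Norms.L2Operator
open NormedSpace

namespace Summit.QuantumFields.BalabanUV.T4Continuum.NE3.PairThm4TorusB8

open Literature.MathematicalPhysics.QuantumFieldTheory.Balaban1983to89
open B7Prop1Explicit B7Prop2Explicit
open B8Lemma1NonAbelian (pert)
open B8Eq166ConstraintPair (ptw)
open B8Eq133Hypotheses (Reg335Zd)
open B8Thm4TorusAt (Thm4TorusAt concl_of_thm4TorusAt_pair)
open B12Ineq417Flat (shiftCfg)
open T4AveragingDeficitWall (IsUnitaryCfg SmallField)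
open MinimalActionSandwich (IsMinimiser)
open MinimalActionRate (Regular sfClass rescale_bavg_mem_sfClass)
open MinimalActionRefine (RegularSup)
open BlockAverageCurrent (curConst curConst_nonneg)
open NE3.PairFrameCondition (avgIter_eq_of_isMinimiser avgIter_rescale_bavg_eq_of_isMinimiser)
open NE3.RemainderTowerPrepB8 (shiftCfg_of_isPeriodicCfg)
open NE3.SupplierB8SfClassPrep (pdev_le_of_smallField)
open NE3.PairClassAkB8 (inAk_pair)
open NE3.PairReg335B8 (reg335Zd_rescale_bavg)

noncomputable section

variable {d : ℕ} {n : Type*} [Fintype n] [DecidableEq n]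

omit [Fintype n] [DecidableEq n] in
/-- `a / t² < α · (t⁻¹)²` for `a < α`, `1 ≤ t`. [folklore] -/
private theorem div_sq_lt {a α t : ℝ} (h : a < α) (ht : 1 ≤ t) : a / t ^ 2 < α * (t⁻¹) ^ 2 := by
  have ht0 : 0 < t := by linarith
  rw [inv_pow, ← div_eq_mul_inv]
  exact div_lt_div_of_pos_right h (by positivity)

/-- **[B8] THEOREM 4 (TORUS GEOMETRY) APPLIES AT THE MINIMISER PAIR — (1.33)'s SECOND CLAUSE DISCHARGED** (statement in the module docstring).
[folklore] -/
theorem concl_of_thm4TorusAt_minimisers_reg335 [Nonempty n] (hd : 1 ≤ d) {L N : ℕ} (hL : 2 ≤ L) {ε b c α : ℝ} {k : ℕ}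
    {V UA UB : Site d → Fin d → (Matrix n n ℂ)ˣ}
    (hA : IsMinimiser d (sfClass d L N ε) L N k V UA) (hB : IsMinimiser d (sfClass d L N ε) L N (k + 1) V UB)
    (hregA : RegularSup d L N b c k UA) (hregB : RegularSup d L N b c (k + 1) UB) (hε : 0 ≤ ε) (hb : 0 ≤ b) (hc : 0 ≤ c)
    (hb4 : b / ((L : ℝ) ^ k) ^ 2 ≤ 1 / 4) (hRb : 2 ^ 15 * ((d : ℝ) + 1) ^ 2 * ((d : ℝ) + 4) ^ 2 * (L : ℝ) ^ 2 * b ≤ 1)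
    (hα : 0 < α) (hεα : ε < α) (hbα : b + 226 * (8 * (d + 1) * (d + 4)) ^ 2 * b ^ 2 < α)
    (hcα : 4 * ((d : ℝ) - 1) * (c + curConst d L * b ^ 2) < α)
    (hα3 : C0 d * α ≤ 1 / 3) (hα2 : 2 * α ≤ c2' d L) (hsmall : 11 * (d : ℝ) ^ 2 * α ≤ 1 / 6)
    {c₁ : ℝ}
    {Mc : ℝ} (hMc : 0 ≤ Mc) (hMcα : (Mc + 1) * (b + 226 * (8 * (d + 1) * (d + 4)) ^ 2 * b ^ 2) ≤ 1 / 2)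
    {𝒬 : Set (Set (Site d) × ℕ)}
    (h𝒬 : ∀ q ∈ 𝒬, q.2 ≤ k ∧ ∃ y : Site d, ∀ z ∈ q.1, (l1 (z - y) : ℝ) ≤ Mc * (L : ℝ) ^ q.2)
    {C : ℝ} (hC : 2 * (Mc + 1) * (b + 226 * (8 * (d + 1) * (d + 4)) ^ 2 * b ^ 2) + 2 * Mc * (2 * (c + curConst d L * b ^ 2)) +
      4 * Mc * (1 + 2 * Mc) * (b + 226 * (8 * (d + 1) * (d + 4)) ^ 2 * b ^ 2) ^ 2 < C)
    {Restr : (Site d → Fin d → (Matrix n n ℂ)ˣ) → (Site d → (Matrix n n ℂ)ˣ) → Prop}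
    {Concl : ℝ → ℝ → (Site d → Fin d → (Matrix n n ℂ)ˣ) → (Site d → Fin d → (Matrix n n ℂ)ˣ) → (Site d → (Matrix n n ℂ)ˣ) → Prop}
    (hThm4 : Thm4TorusAt L k (((N * L ^ k : ℕ) : ℤ)) (((L : ℝ) ^ k)⁻¹) c₁ (unitaryUnits (Matrix n n ℂ))
      (Reg335Zd (((L : ℝ) ^ k)⁻¹) L 𝒬 C) Restr Concl)
    (hc₁ : α + 11 * (d : ℝ) ^ 2 * α ≤ c₁) :
    ∃ u : Site d → (Matrix n n ℂ)ˣ,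
      ((∀ x, u x ∈ unitaryUnits (Matrix n n ℂ)) ∧ (∀ (x : Site d) (i : Fin d), u (x + (((N * L ^ k : ℕ) : ℤ)) • e i) = u x) ∧
        Restr (rescale L (bavg L UB)) u ∧
        Concl α (11 * (d : ℝ) ^ 2 * α) (rescale L (bavg L UB))
          (pert (gaugeAct (ptw L (rescale L (bavg L UB)) UA k) UA) (rescale L (bavg L UB))) u) ∧
      ∀ u' : Site d → (Matrix n n ℂ)ˣ, (∀ x, u' x ∈ unitaryUnits (Matrix n n ℂ)) →
        (∀ (x : Site d) (i : Fin d), u' (x + (((N * L ^ k : ℕ) : ℤ)) • e i) = u' x) → Restr (rescale L (bavg L UB)) u' →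
        Concl α (11 * (d : ℝ) ^ 2 * α) (rescale L (bavg L UB))
          (pert (gaugeAct (ptw L (rescale L (bavg L UB)) UA k) UA) (rescale L (bavg L UB))) u' → u' = u := by
  letI : CStarAlgebra (Matrix n n ℂ) := {}
  have hL1 : 1 ≤ L := le_trans (by norm_num) hL
  have hL1r : (1 : ℝ) ≤ L := by exact_mod_cast hL1
  have hLk : (1 : ℝ) ≤ (L : ℝ) ^ k := one_le_pow₀ hL1r
  have hG := avgClosed_unitaryUnits d (𝔸 := Matrix n n ℂ) L
  set W : Site d → Fin d → (Matrix n n ℂ)ˣ := rescale L (bavg L UB) with hWdef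
  obtain ⟨hAu, hAP, hAsm⟩ := hA.mem.1
  have hbs : 512 * (d + 1) * (d + 4) * (L : ℝ) ^ 2 * b ≤ 1 := by
    have hd0 : (0 : ℝ) ≤ d := Nat.cast_nonneg d
    have h1 : (512 : ℝ) * (d + 1) * (d + 4) ≤ 2 ^ 15 * ((d : ℝ) + 1) ^ 2 * ((d : ℝ) + 4) ^ 2 := by nlinarith
    have hL2b : 0 ≤ (L : ℝ) ^ 2 * b := by positivity
    nlinarith
  have hregB' : Regular d L N b (MinimalActionRefine.gradConst d c) (k + 1) UB := hregB.regular
  obtain ⟨hWu, hWP, hWsm⟩ := rescale_bavg_mem_sfClass hL1 hb hbs le_rfl hregB'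
  have hb' : 0 ≤ b + 226 * (8 * (d + 1) * (d + 4)) ^ 2 * b ^ 2 := by positivity
  have h34 : pdev UA < α * (((L : ℝ) ^ k)⁻¹) ^ 2 :=
    (pdev_le_of_smallField (div_nonneg hε (by positivity)) hAsm).trans_lt (div_sq_lt hεα hLk)
  have h33 : pdev W < α * (((L : ℝ) ^ k)⁻¹) ^ 2 :=
    (pdev_le_of_smallField (div_nonneg hb' (by positivity)) hWsm).trans_lt (div_sq_lt hbα hLk)
  have hpair : avgIter L UA k = avgIter L W k := by
    rw [avgIter_eq_of_isMinimiser hA, hWdef, avgIter_rescale_bavg_eq_of_isMinimiser hB]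
  have hAshift : ∀ i : Fin d, shiftCfg (((N * L ^ k : ℕ) : ℤ) • e i) UA = UA := fun i => shiftCfg_of_isPeriodicCfg hAP (e i)
  have hWshift : ∀ i : Fin d, shiftCfg (((N * L ^ k : ℕ) : ℤ) • e i) W = W := fun i => shiftCfg_of_isPeriodicCfg hWP (e i)
  obtain ⟨hAkW, hAkA, -⟩ := inAk_pair hd hL1 hA hB hregA hregB hb hc hb4 hRb hα.le hbα hcα (fun _ => Set.univ)
    (u₀ := fun _ => (1 : (Matrix n n ℂ)ˣ)) (fun _ => (unitaryUnits (Matrix n n ℂ)).one_mem)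
  have hReg : Reg335Zd (((L : ℝ) ^ k)⁻¹) L 𝒬 C W := reg335Zd_rescale_bavg hL1 hregB hb hc hRb hMc hMcα h𝒬 hC
  exact concl_of_thm4TorusAt_pair L hL hd hG N k hThm4 W UA hWu hAu hWshift hAshift hα hα3 hα2 h33 h34 hpair hsmall hc₁ hAkW hReg hAkA

end

end Summit.QuantumFields.BalabanUV.T4Continuum.NE3.PairThm4TorusB8
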